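import Summits.Parity.BatemanHorn.Theorems.SoloInformedHooleyShiftAssembly
import Literature.NumberTheory.Sieve.FriableCellCounting
import Literature.Barriers.Parity.FordFixedLevelProofs

/-!
# The main bound and the Hooley-shift target: `HooleyShiftUniform g η` (`η > 1 − 2/d`) ⇒ Erdős's asymptotic

Informed soloist `solo-Parity-informed` (session 142), conjunct `BatemanHorn`, the `d ≥ 3` rung BELOW the parity
wall; last file of the chain `SoloInformedSmoothHyperbola → …Fourier → …Reduction → SoloInformedHooleyShiftHypothesis
→ …Weights → …Blocks → …Assembly`.

* `norm_polySmoothMid_sub_heur_le` — **MAIN BOUND**: for `g` irreducible of degree `d ≥ 2`, `Δ > 0` and the dyadic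
  hypothesis with exponent `η ≤ 1`, constant `C ≥ 0`:
  `|Mid^w_g(x) − H^w_g(x; E_g(x))| ≤ K·(1 + log x)^4·x^{(d/2)(1−η)}` (`x ≥ X₀`) — summing the block estimate over
  `1 ≤ m < x` (weights `δ_m ≪ 1/m`) and the frequencies `h` (weights `1/|h|`), two harmonic sums
  (`FriableCell.sum_Ico_one_div_le`, `Ford2004.sum_Icc_one_div_le`);
* `hooleyShiftTarget` — **THE CONDITIONAL THEOREM** `HooleyShiftTarget g` for `g` irreducible of degree `d ≥ 3`:
  a uniform power saving `η > 1 − 2/d` in the shifted incomplete Hooley sums over dyadic modulus ranges implies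
  `WindowRootEquidistribution g`, i.e. (by `SoloInformedLocatedHeuristic`) Erdős's conjectured asymptotic
  `Σ_{n≤x} τ(g(n)) ~ d·A_g·x log x`; for cubics the threshold is `η > 1/3`.  Hooley's classical saving for
  complete sums is `η = 1/2`-type on average over `h`; the hypothesis asks for it uniformly in the shift `b` and
  the length — this is the precise "Hooley-sum currency" of the `d ≥ 3` located-count problem (PLAN §107).
-/

namespace Summit.Parity.BatemanHorn.Theorems

open Finset Polynomial Filter Topology Asymptotics

/-! ### Summing the blocks: the main bound -/

/-- `Σ_{1≤h≤H} Σ_{1≤m<x} A/(mh) ≤ A(1 + log x)(1 + log H)` (`A ≥ 0`). [folklore] -/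
theorem sum_sum_div_mul_le {A : ℝ} (hA : 0 ≤ A) (x H : ℕ) :
    ∑ h ∈ Icc 1 H, ∑ m ∈ Ico 1 x, A / ((m : ℝ) * h) ≤ A * (1 + Real.log x) * (1 + Real.log H) := by
  have hlogH := Real.log_natCast_nonneg H
  calc ∑ h ∈ Icc 1 H, ∑ m ∈ Ico 1 x, A / ((m : ℝ) * h)
      = A * ((∑ h ∈ Icc 1 H, 1 / (h : ℝ)) * (∑ m ∈ Ico 1 x, 1 / (m : ℝ))) := by
        rw [sum_mul_sum, mul_sum]
        refine sum_congr rfl fun h _ => ?_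
        rw [mul_sum]
        refine sum_congr rfl fun m _ => ?_
        rw [one_div_mul_one_div, mul_one_div, mul_comm (h : ℝ)]
    _ ≤ A * ((1 + Real.log H) * (1 + Real.log x)) := by
        refine mul_le_mul_of_nonneg_left ?_ hA
        exact mul_le_mul (Literature.Barriers.Parity.Ford2004.sum_Icc_one_div_le H)
          (Literature.NumberTheory.Sieve.FriableCell.sum_Ico_one_div_le x)
          (sum_nonneg fun _ _ => by positivity) (by linarith)
    _ = A * (1 + Real.log x) * (1 + Real.log H) := by ring

set_option maxHeartbeats 800000 in
/-- **MAIN BOUND.**  For `g` irreducible of degree `d ≥ 2`, `Δ > 0`, and the dyadic hypothesis with exponent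
`η ≤ 1` and constant `C ≥ 0`: there are `K, X₀` with
`|Mid^w_g(x) − H^w_g(x; E_g(x))| ≤ K·(1 + log x)^4·x^{(d/2)(1−η)}` for all `x ≥ X₀`. [this work] -/
theorem norm_polySmoothMid_sub_heur_le {g : ℤ[X]} (hirr : Irreducible g) (hdeg : 2 ≤ g.natDegree)
    {η C : ℝ} (hη : η ≤ 1) (hC0 : 0 ≤ C)
    (hC : ∀ (h b : ℤ) (E E' : ℕ), h ≠ 0 → 1 ≤ E → E ≤ E' → E' ≤ 2 * E → |h| ≤ E → 0 ≤ b → b ≤ 2 * E →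
      ‖∑ e ∈ Ioc E E', hooleySumShift g e h b‖ ≤ C * (E : ℝ) ^ (1 - η))
    {Δ : ℝ} (hΔ : 0 < Δ) :
    ∃ K : ℝ, ∃ X₀ : ℕ, ∀ x : ℕ, X₀ ≤ x →
      ‖((polySmoothMid g Δ x : ℝ) : ℂ) - ((polySmoothHeur g Δ x (polyEvalSup g x) : ℝ) : ℂ)‖
        ≤ K * (1 + Real.log x) ^ 4 * (x : ℝ) ^ ((g.natDegree : ℝ) / 2 * (1 - η)) := by
  obtain ⟨Cδ, hCδ⟩ := exists_abs_log_natAbs_succ_sub_le hirr hdeg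
  obtain ⟨B, hB⟩ := exists_abs_log_natAbs_eval_sub_le (g := g) (by omega)
  have hg0 : ∀ n : ℕ, g.eval (n : ℤ) ≠ 0 := eval_natCast_ne_zero_of_irreducible hirr hdeg
  have hB0 : 0 ≤ B := (abs_nonneg _).trans (hB 1 le_rfl)
  have hCδ0 : 0 ≤ Cδ := by
    have := (abs_nonneg _).trans (hCδ 1 le_rfl)
    simpa using this
  set d : ℕ := g.natDegree with hd
  have hd0 : (0 : ℝ) ≤ d := Nat.cast_nonneg _
  set Λ₀ : ℝ := Δ + (B + Cδ) / 2 with hΛ₀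
  have hΛ₀0 : 0 ≤ Λ₀ := by rw [hΛ₀]; linarith
  set M₁ : ℝ := 2 * (2 + Λ₀ + d / 2) * (1 + 2 * Λ₀ + d) * Real.exp (Λ₀ * (1 - η)) with hM₁
  set K : ℝ := 2 * (Cδ / (4 * Δ) * C * M₁) * (1 + B + d) with hK
  refine ⟨K, max 1 ⌊Real.exp Δ * Real.sqrt ((g.eval ((1 : ℕ) : ℤ)).natAbs : ℝ)⌋₊, fun x hx => ?_⟩
  have hx1 : 1 ≤ x := le_trans (le_max_left _ _) hx
  have hxfl : ⌊Real.exp Δ * Real.sqrt ((g.eval ((1 : ℕ) : ℤ)).natAbs : ℝ)⌋₊ ≤ x :=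
    le_trans (le_max_right _ _) hx
  have hx0 : (0 : ℝ) < x := by exact_mod_cast hx1
  set L : ℝ := Real.log x with hL
  have hL0 : 0 ≤ L := Real.log_nonneg (by exact_mod_cast hx1)
  set E : ℕ := polyEvalSup g x with hE
  set γ : ℝ := (d : ℝ) / 2 * (1 - η) with hγ
  -- `a_e(1) = 0` for every modulus `e > x`
  have ha1 : ∀ e : ℕ, x < e → locWeight g Δ e 1 = 0 := by
    intro e he
    refine locWeight_eq_zero_of_sqrt_lt g hΔ (hg0 1) ?_
    have h0 : 0 ≤ Real.exp Δ * Real.sqrt ((g.eval ((1 : ℕ) : ℤ)).natAbs : ℝ) := by positivity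
    exact (Nat.floor_lt h0).mp (by omega)
  -- sizes of the values and the common cut bound `U = e^Λ`
  have hlogN : ∀ n : ℕ, 1 ≤ n → n ≤ x → Real.log ((g.eval (n : ℤ)).natAbs : ℝ) ≤ d * L + B := by
    intro n hn hnx
    have h1 := (abs_le.mp (hB n hn)).2
    have h2 : Real.log (n : ℝ) ≤ L := Real.log_le_log (by exact_mod_cast hn) (by exact_mod_cast hnx)
    have h3 : (d : ℝ) * Real.log n ≤ d * L := mul_le_mul_of_nonneg_left h2 hd0
    linarith
  set Λ : ℝ := Λ₀ + (d : ℝ) / 2 * L with hΛ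
  have hΛ0 : 0 ≤ Λ := add_nonneg hΛ₀0 (mul_nonneg (div_nonneg hd0 (by norm_num)) hL0)
  set U : ℝ := Real.exp Λ with hU
  have hU1 : 1 ≤ U := Real.one_le_exp hΛ0
  have hcutU : ∀ m ∈ Ico 1 x, (modulusCut g Δ m : ℝ) ≤ U := by
    intro m hm
    rw [mem_Ico] at hm
    have hNm := hlogN m hm.1 hm.2.le
    have hNm1 : Real.log ((g.eval ((m + 1 : ℕ) : ℤ)).natAbs : ℝ) ≤ d * L + B + Cδ := by
      have h1 := (abs_le.mp (hCδ m hm.1)).2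
      have h2 : Cδ / m ≤ Cδ := div_le_self hCδ0 (by exact_mod_cast hm.1)
      have h3 : ((m + 1 : ℕ) : ℤ) = (m : ℤ) + 1 := by push_cast; ring
      rw [h3]
      linarith
    have hmax : max ((g.eval (m : ℤ)).natAbs : ℝ) ((g.eval ((m + 1 : ℕ) : ℤ)).natAbs : ℝ)
        ≤ Real.exp (d * L + B + Cδ) := by
      refine max_le ?_ ?_
      · have hpos : (0 : ℝ) < ((g.eval (m : ℤ)).natAbs : ℝ) := by
          exact_mod_cast Int.natAbs_pos.mpr (hg0 m)
        calc ((g.eval (m : ℤ)).natAbs : ℝ) = Real.exp (Real.log ((g.eval (m : ℤ)).natAbs : ℝ)) :=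
              (Real.exp_log hpos).symm
          _ ≤ Real.exp (d * L + B + Cδ) := Real.exp_le_exp.mpr (by linarith)
      · have hpos : (0 : ℝ) < ((g.eval ((m + 1 : ℕ) : ℤ)).natAbs : ℝ) := by
          exact_mod_cast Int.natAbs_pos.mpr (hg0 (m + 1))
        calc ((g.eval ((m + 1 : ℕ) : ℤ)).natAbs : ℝ)
            = Real.exp (Real.log ((g.eval ((m + 1 : ℕ) : ℤ)).natAbs : ℝ)) := (Real.exp_log hpos).symm
          _ ≤ Real.exp (d * L + B + Cδ) := Real.exp_le_exp.mpr hNm1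
    calc (modulusCut g Δ m : ℝ) ≤ Real.exp Δ * Real.sqrt (max _ _) := modulusCut_le g Δ m
      _ ≤ Real.exp Δ * Real.sqrt (Real.exp (d * L + B + Cδ)) :=
          mul_le_mul_of_nonneg_left (Real.sqrt_le_sqrt hmax) (Real.exp_pos Δ).le
      _ = Real.exp (Δ + (d * L + B + Cδ) / 2) := by rw [← Real.exp_half, ← Real.exp_add]
      _ = U := by rw [hU, hΛ, hΛ₀]; congr 1; ring
  -- the constant of one block
  set A : ℝ := Cδ / (4 * Δ) * (C * blockMajorant η U) with hA
  have hΦ0 : 0 ≤ C * blockMajorant η U := mul_nonneg hC0 (blockMajorant_nonneg η hU1)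
  have hA0 : 0 ≤ A := mul_nonneg (div_nonneg hCδ0 (by linarith)) hΦ0
  have hblock : ∀ m ∈ Ico 1 x, ∀ (h : ℤ) (E₀ : ℕ), h ≠ 0 → x ≤ E₀ → 2 * |h| ≤ (E₀ : ℤ) + 1 →
      ‖∑ e ∈ Ioc E₀ E, modWeight e h * ((locWeight g Δ e (m + 1) - locWeight g Δ e m : ℝ) : ℂ)
          * (hooleySumShift g e h ((x : ℤ) + 1) - hooleySumShift g e h ((m : ℤ) + 1))‖
        ≤ A / ((m : ℝ) * |(h : ℝ)|) := by
    intro m hm h E₀ h0 hxE₀ h2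
    have hm' := hm
    rw [mem_Ico] at hm'
    refine (norm_sum_block_le hη hC0 hC hΔ hx1 hm (hg0 m) (hg0 (m + 1)) h0 E hxE₀ h2 hU1 (hcutU m hm)).trans ?_
    have hδ : |Real.log ((g.eval ((m + 1 : ℕ) : ℤ)).natAbs : ℝ) - Real.log ((g.eval (m : ℤ)).natAbs : ℝ)|
        ≤ Cδ / m := by
      have h3 : ((m + 1 : ℕ) : ℤ) = (m : ℤ) + 1 := by push_cast; ring
      rw [h3]
      exact hCδ m hm'.1
    have hm0 : (0 : ℝ) < m := by exact_mod_cast hm'.1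
    have habs : (0 : ℝ) < |(h : ℝ)| := abs_pos.mpr (by exact_mod_cast h0)
    calc |Real.log ((g.eval ((m + 1 : ℕ) : ℤ)).natAbs : ℝ) - Real.log ((g.eval (m : ℤ)).natAbs : ℝ)| / (4 * Δ)
          / |(h : ℝ)| * (C * blockMajorant η U)
        ≤ Cδ / m / (4 * Δ) / |(h : ℝ)| * (C * blockMajorant η U) :=
          mul_le_mul_of_nonneg_right (div_le_div_of_nonneg_right
            (div_le_div_of_nonneg_right hδ (by linarith)) habs.le) hΦ0
      _ = A / ((m : ℝ) * |(h : ℝ)|) := by rw [hA]; ring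
  -- `log E ≤ d log x + B`, hence `1 + log H ≤ (1 + B + d)(1 + log x)` for `H ≤ E`
  have hlogE : Real.log (E : ℝ) ≤ d * L + B := by
    have hne : (Icc 1 x).Nonempty := ⟨1, by rw [mem_Icc]; omega⟩
    obtain ⟨n₀, hn₀, hEn₀⟩ : ∃ n₀ ∈ Icc 1 x, E = (g.eval (n₀ : ℤ)).natAbs := by
      rw [hE]
      unfold polyEvalSup
      exact exists_mem_eq_sup _ hne _
    rw [mem_Icc] at hn₀
    rw [hEn₀]
    exact hlogN n₀ hn₀.1 hn₀.2
  have hlogH : ∀ H : ℕ, H ≤ E → 1 + Real.log (H : ℝ) ≤ (1 + B + d) * (1 + L) := by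
    intro H hH
    have h1 : Real.log (H : ℝ) ≤ Real.log (E : ℝ) := by
      rcases Nat.eq_zero_or_pos H with hH0 | hH0
      · rw [hH0, Nat.cast_zero, Real.log_zero]; exact Real.log_natCast_nonneg E
      · exact Real.log_le_log (by exact_mod_cast hH0) (by exact_mod_cast hH)
    nlinarith [mul_nonneg hB0 hL0, mul_nonneg hd0 hL0]
  -- the two families of frequencies
  have hplus : ‖∑ e ∈ Ioc x E, ∑ h ∈ Icc 1 ((e - 1) / 2), trilinearTerm g Δ x e h‖
      ≤ A * (1 + L) * ((1 + B + d) * (1 + L)) := by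
    have hexp : ∑ e ∈ Ioc x E, ∑ h ∈ Icc 1 ((e - 1) / 2), trilinearTerm g Δ x e h
        = ∑ h ∈ Icc 1 ((E - 1) / 2), ∑ m ∈ Ico 1 x, ∑ e ∈ Ioc (max x (2 * h)) E,
            modWeight e h * ((locWeight g Δ e (m + 1) - locWeight g Δ e m : ℝ) : ℂ)
              * (hooleySumShift g e h ((x : ℤ) + 1) - hooleySumShift g e h ((m : ℤ) + 1)) := by
      rw [sum_Ioc_sum_Icc_half_comm]
      refine sum_congr rfl fun h _ => ?_
      rw [sum_comm]
      refine sum_congr rfl fun e he => ?_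
      rw [mem_Ioc, max_lt_iff] at he
      exact trilinearTerm_eq_sum_Ico g Δ hx1 (ha1 e he.1.1) h
    rw [hexp]
    refine (norm_sum_le _ _).trans ?_
    calc ∑ h ∈ Icc 1 ((E - 1) / 2), ‖∑ m ∈ Ico 1 x, ∑ e ∈ Ioc (max x (2 * h)) E,
            modWeight e h * ((locWeight g Δ e (m + 1) - locWeight g Δ e m : ℝ) : ℂ)
              * (hooleySumShift g e h ((x : ℤ) + 1) - hooleySumShift g e h ((m : ℤ) + 1))‖
        ≤ ∑ h ∈ Icc 1 ((E - 1) / 2), ∑ m ∈ Ico 1 x, A / ((m : ℝ) * h) := by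
          refine sum_le_sum fun h hh => (norm_sum_le _ _).trans (sum_le_sum fun m hm => ?_)
          rw [mem_Icc] at hh
          have h2 : 2 * |((h : ℕ) : ℤ)| ≤ ((max x (2 * h) : ℕ) : ℤ) + 1 := by
            have : ((2 * h : ℕ) : ℤ) ≤ ((max x (2 * h) : ℕ) : ℤ) := by exact_mod_cast le_max_right _ _
            rw [Nat.abs_cast]
            push_cast at this ⊢
            linarith
          have := hblock m hm (h : ℤ) (max x (2 * h)) (by exact_mod_cast (by omega : h ≠ 0))
            (le_max_left _ _) h2
          rwa [Int.cast_natCast, Nat.abs_cast] at this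
      _ ≤ A * (1 + L) * (1 + Real.log (((E - 1) / 2 : ℕ) : ℝ)) := sum_sum_div_mul_le hA0 x _
      _ ≤ A * (1 + L) * ((1 + B + d) * (1 + L)) :=
          mul_le_mul_of_nonneg_left (hlogH _ (by omega)) (mul_nonneg hA0 (by linarith))
  have hminus : ‖∑ e ∈ Ioc x E, ∑ k ∈ Icc 1 (e / 2), trilinearTerm g Δ x e (-(k : ℤ))‖
      ≤ A * (1 + L) * ((1 + B + d) * (1 + L)) := by
    have hexp : ∑ e ∈ Ioc x E, ∑ k ∈ Icc 1 (e / 2), trilinearTerm g Δ x e (-(k : ℤ))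
        = ∑ k ∈ Icc 1 (E / 2), ∑ m ∈ Ico 1 x, ∑ e ∈ Ioc (max x (2 * k - 1)) E,
            modWeight e (-(k : ℤ)) * ((locWeight g Δ e (m + 1) - locWeight g Δ e m : ℝ) : ℂ)
              * (hooleySumShift g e (-(k : ℤ)) ((x : ℤ) + 1) - hooleySumShift g e (-(k : ℤ)) ((m : ℤ) + 1)) := by
      rw [sum_Ioc_sum_Icc_half_comm']
      refine sum_congr rfl fun k _ => ?_
      rw [sum_comm]
      refine sum_congr rfl fun e he => ?_
      rw [mem_Ioc, max_lt_iff] at he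
      exact trilinearTerm_eq_sum_Ico g Δ hx1 (ha1 e he.1.1) _
    rw [hexp]
    refine (norm_sum_le _ _).trans ?_
    calc ∑ k ∈ Icc 1 (E / 2), ‖∑ m ∈ Ico 1 x, ∑ e ∈ Ioc (max x (2 * k - 1)) E,
            modWeight e (-(k : ℤ)) * ((locWeight g Δ e (m + 1) - locWeight g Δ e m : ℝ) : ℂ)
              * (hooleySumShift g e (-(k : ℤ)) ((x : ℤ) + 1) - hooleySumShift g e (-(k : ℤ)) ((m : ℤ) + 1))‖
        ≤ ∑ k ∈ Icc 1 (E / 2), ∑ m ∈ Ico 1 x, A / ((m : ℝ) * k) := by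
          refine sum_le_sum fun k hk => (norm_sum_le _ _).trans (sum_le_sum fun m hm => ?_)
          rw [mem_Icc] at hk
          have h2 : 2 * |(-((k : ℕ) : ℤ))| ≤ ((max x (2 * k - 1) : ℕ) : ℤ) + 1 := by
            have : ((2 * k - 1 : ℕ) : ℤ) ≤ ((max x (2 * k - 1) : ℕ) : ℤ) := by
              exact_mod_cast le_max_right _ _
            rw [abs_neg, Nat.abs_cast]
            have h21 : ((2 * k - 1 : ℕ) : ℤ) = 2 * (k : ℤ) - 1 := by omega
            linarith
          have := hblock m hm (-(k : ℤ)) (max x (2 * k - 1))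
            (neg_ne_zero.mpr (by exact_mod_cast (by omega : k ≠ 0))) (le_max_left _ _) h2
          rwa [Int.cast_neg, Int.cast_natCast, abs_neg, Nat.abs_cast] at this
      _ ≤ A * (1 + L) * (1 + Real.log ((E / 2 : ℕ) : ℝ)) := sum_sum_div_mul_le hA0 x _
      _ ≤ A * (1 + L) * ((1 + B + d) * (1 + L)) :=
          mul_le_mul_of_nonneg_left (hlogH _ (Nat.div_le_self _ _)) (mul_nonneg hA0 (by linarith))
  -- the block majorant at `U = e^Λ` is `≤ M₁ (1 + log x)² x^γ`
  have hΦ : blockMajorant η U ≤ M₁ * (1 + L) ^ 2 * (x : ℝ) ^ γ := by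
    have hlogU : Real.log U = Λ := Real.log_exp Λ
    have hpowU : U ^ (1 - η) = Real.exp (Λ₀ * (1 - η)) * (x : ℝ) ^ γ := by
      rw [hU, ← Real.exp_mul, Real.rpow_def_of_pos hx0, ← Real.exp_add]
      congr 1
      rw [hΛ, hγ]
      ring
    have h1 : 2 + Λ ≤ (2 + Λ₀ + d / 2) * (1 + L) := by
      rw [hΛ]; nlinarith [mul_nonneg hΛ₀0 hL0, mul_nonneg hd0 hL0]
    have h2 : 1 + 2 * Λ ≤ (1 + 2 * Λ₀ + d) * (1 + L) := by
      rw [hΛ]; nlinarith [mul_nonneg hΛ₀0 hL0, mul_nonneg hd0 hL0]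
    have hpos2 : 0 ≤ 1 + 2 * Λ := by linarith
    have hb0 : 0 ≤ (2 + Λ₀ + d / 2) * (1 + L) := mul_nonneg (by linarith) (by linarith)
    have h12 : (2 + Λ) * (1 + 2 * Λ) ≤ ((2 + Λ₀ + d / 2) * (1 + L)) * ((1 + 2 * Λ₀ + d) * (1 + L)) :=
      _root_.mul_le_mul h1 h2 hpos2 hb0
    have hX : 0 ≤ Real.exp (Λ₀ * (1 - η)) * (x : ℝ) ^ γ :=
      mul_nonneg (Real.exp_pos _).le (Real.rpow_nonneg hx0.le _)
    unfold blockMajorant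
    rw [hlogU, hpowU]
    calc 2 * (2 + Λ) * (1 + 2 * Λ) * (Real.exp (Λ₀ * (1 - η)) * (x : ℝ) ^ γ)
        ≤ 2 * ((2 + Λ₀ + d / 2) * (1 + L)) * ((1 + 2 * Λ₀ + d) * (1 + L))
            * (Real.exp (Λ₀ * (1 - η)) * (x : ℝ) ^ γ) :=
          mul_le_mul_of_nonneg_right (by linarith) hX
      _ = M₁ * (1 + L) ^ 2 * (x : ℝ) ^ γ := by rw [hM₁]; ring
  have hfin : 2 * (A * (1 + L) * ((1 + B + d) * (1 + L))) ≤ K * (1 + L) ^ 4 * (x : ℝ) ^ γ := by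
    have hC' : 0 ≤ Cδ / (4 * Δ) * C := mul_nonneg (div_nonneg hCδ0 (by linarith)) hC0
    have h3 : A ≤ Cδ / (4 * Δ) * C * (M₁ * (1 + L) ^ 2 * (x : ℝ) ^ γ) := by
      rw [hA, ← mul_assoc]
      exact mul_le_mul_of_nonneg_left hΦ hC'
    have h4 : 0 ≤ (1 + L) * ((1 + B + d) * (1 + L)) :=
      mul_nonneg (by linarith) (mul_nonneg (by linarith) (by linarith))
    calc 2 * (A * (1 + L) * ((1 + B + d) * (1 + L)))
        = 2 * A * ((1 + L) * ((1 + B + d) * (1 + L))) := by ring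
      _ ≤ 2 * (Cδ / (4 * Δ) * C * (M₁ * (1 + L) ^ 2 * (x : ℝ) ^ γ))
            * ((1 + L) * ((1 + B + d) * (1 + L))) :=
          mul_le_mul_of_nonneg_right (by linarith) h4
      _ = K * (1 + L) ^ 4 * (x : ℝ) ^ γ := by rw [hK]; ring
  -- assemble
  rw [polySmoothMid_sub_heur_eq_fold g Δ hx1 (fun n _ => hg0 n) (fun n hn => natAbs_eval_le_polyEvalSup g hn),
    sum_add_distrib]
  refine (norm_add_le _ _).trans ?_
  linarith [hplus, hminus, hfin]

/-! ### The conditional theorem -/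

/-- **THE HOOLEY-SHIFT TARGET HOLDS** (`g` irreducible, `deg g ≥ 3`): a uniform power saving `η > 1 − 2/deg g` in
the shifted incomplete Hooley sums over dyadic ranges of moduli (`HooleyShiftUniform g η`) implies the root
equidistribution in the located windows, hence Erdős's asymptotic for `Σ_{n≤x} τ(g(n))`
(`erdosDivisorSumAsymptotic_of_target`). [this work] -/
theorem hooleyShiftTarget {g : ℤ[X]} (hirr : Irreducible g) (hdeg : 3 ≤ g.natDegree) : HooleyShiftTarget g := by
  intro η hη hHSU
  set d : ℕ := g.natDegree with hd
  have hd0 : (0 : ℝ) < d := by exact_mod_cast (by omega : 0 < d)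
  -- reduce to an exponent `η₁ ≤ 1` and a constant `C ≥ 0`
  set η₁ : ℝ := min η 1 with hη₁
  have hη₁1 : η₁ ≤ 1 := min_le_right _ _
  have h2d : 0 < 2 / (d : ℝ) := by positivity
  have hη₁lt : 1 - 2 / (d : ℝ) < η₁ := lt_min hη (by linarith)
  obtain ⟨C, hC⟩ := hHSU.mono (min_le_left η 1)
  have hC' : ∀ (h b : ℤ) (E E' : ℕ), h ≠ 0 → 1 ≤ E → E ≤ E' → E' ≤ 2 * E → |h| ≤ E → 0 ≤ b → b ≤ 2 * E →
      ‖∑ e ∈ Ioc E E', hooleySumShift g e h b‖ ≤ max C 0 * (E : ℝ) ^ (1 - η₁) :=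
    fun h b E E' h0 hE hEE' hE' hh hb hbE => (hC h b E E' h0 hE hEE' hE' hh hb hbE).trans
      (mul_le_mul_of_nonneg_right (le_max_left _ _) (Real.rpow_nonneg (Nat.cast_nonneg _) _))
  obtain ⟨K, X₀, hK⟩ :=
    norm_polySmoothMid_sub_heur_le hirr (by omega) hη₁1 (le_max_right C 0) hC' (Δ := 1) one_pos
  set γ : ℝ := (d : ℝ) / 2 * (1 - η₁) with hγ
  have hγ1 : γ < 1 := by
    have h1 : (d : ℝ) / 2 * (1 - η₁) < (d : ℝ) / 2 * (2 / d) := mul_lt_mul_of_pos_left (by linarith) (by positivity)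
    have h2 : (d : ℝ) / 2 * (2 / d) = 1 := by field_simp
    linarith
  refine (windowRootEquidistribution_iff_smooth hirr hdeg one_pos).mpr ?_
  -- the majorant `16·max(K,0)·(log x)^3 / x^{1−γ} → 0`
  have hlim : Tendsto (fun x : ℕ => 16 * max K 0 * (Real.log (x : ℝ) ^ (3 : ℝ) / (x : ℝ) ^ (1 - γ)))
      atTop (𝓝 0) := by
    have h1 : Tendsto (fun t : ℝ => Real.log t ^ (3 : ℝ) / t ^ (1 - γ)) atTop (𝓝 0) :=
      (isLittleO_log_rpow_rpow_atTop 3 (by linarith : 0 < 1 - γ)).tendsto_div_nhds_zero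
    have h2 := (h1.comp tendsto_natCast_atTop_atTop).const_mul (16 * max K 0)
    rw [mul_zero] at h2
    exact h2
  refine squeeze_zero_norm' ?_ hlim
  filter_upwards [eventually_ge_atTop (max X₀ 3)] with x hx
  have hxX₀ : X₀ ≤ x := le_trans (le_max_left _ _) hx
  have hx3 : 3 ≤ x := le_trans (le_max_right _ _) hx
  have hx0 : (0 : ℝ) < x := by exact_mod_cast (by omega : 0 < x)
  set L : ℝ := Real.log x with hL
  have hL1 : 1 ≤ L := by
    rw [hL, Real.le_log_iff_exp_le hx0]
    have := Real.exp_one_lt_d9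
    have h3 : (3 : ℝ) ≤ x := by exact_mod_cast hx3
    linarith
  have hxL : 0 < (x : ℝ) * L := mul_pos hx0 (by linarith)
  have hD : |polySmoothMid g 1 x - polySmoothHeur g 1 x (polyEvalSup g x)| ≤ K * (1 + L) ^ 4 * (x : ℝ) ^ γ := by
    have := hK x hxX₀
    rwa [← Complex.ofReal_sub, Complex.norm_real, Real.norm_eq_abs] at this
  have hL3 : L ^ (3 : ℝ) = L ^ 3 := by exact_mod_cast Real.rpow_natCast L 3
  have hxγ : (x : ℝ) / (x : ℝ) ^ (1 - γ) = (x : ℝ) ^ γ := by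
    calc (x : ℝ) / (x : ℝ) ^ (1 - γ) = (x : ℝ) ^ (1 : ℝ) / (x : ℝ) ^ (1 - γ) := by rw [Real.rpow_one]
      _ = (x : ℝ) ^ (1 - (1 - γ)) := (Real.rpow_sub hx0 1 (1 - γ)).symm
      _ = (x : ℝ) ^ γ := by congr 1; ring
  rw [Real.norm_eq_abs, abs_div, abs_of_pos hxL, div_le_iff₀ hxL]
  have h16 : (1 + L) ^ 4 ≤ 16 * L ^ 4 := by
    -- `(1 + L)^4 ≤ (2L)^4` (also in the tree as `BarkerPrange2020.one_add_pow_four_le_of_one_le`)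
    have h := pow_le_pow_left₀ (by linarith : (0 : ℝ) ≤ 1 + L) (by linarith : 1 + L ≤ 2 * L) 4
    linarith [h, show (2 * L) ^ 4 = 16 * L ^ 4 by ring]
  have hKK : K * (1 + L) ^ 4 ≤ max K 0 * (16 * L ^ 4) :=
    (mul_le_mul_of_nonneg_right (le_max_left K 0) (by positivity)).trans
      (mul_le_mul_of_nonneg_left h16 (le_max_right K 0))
  calc |polySmoothMid g 1 x - polySmoothHeur g 1 x (polyEvalSup g x)|
      ≤ K * (1 + L) ^ 4 * (x : ℝ) ^ γ := hD
    _ ≤ max K 0 * (16 * L ^ 4) * (x : ℝ) ^ γ :=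
        mul_le_mul_of_nonneg_right hKK (Real.rpow_nonneg hx0.le _)
    _ = max K 0 * (16 * L ^ 4) * ((x : ℝ) / (x : ℝ) ^ (1 - γ)) := by rw [hxγ]
    _ = 16 * max K 0 * (L ^ (3 : ℝ) / (x : ℝ) ^ (1 - γ)) * ((x : ℝ) * L) := by
        rw [hL3, div_eq_mul_inv, div_eq_mul_inv]; ring

/-- **Corollary** (`g` irreducible, `deg g ≥ 3`, `η > 1 − 2/deg g`): `HooleyShiftUniform g η` implies Erdős's
asymptotic `Σ_{n≤x} τ(g(n)) ~ deg g · A_g · x log x`. [this work] -/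
theorem erdosDivisorSumAsymptotic_of_hooleyShiftUniform {g : ℤ[X]} (hirr : Irreducible g)
    (hdeg : 3 ≤ g.natDegree) {η : ℝ} (hη : 1 - 2 / (g.natDegree : ℝ) < η) (h : HooleyShiftUniform g η) :
    ErdosDivisorSumAsymptotic g :=
  erdosDivisorSumAsymptotic_of_target hirr (by omega) (hooleyShiftTarget hirr hdeg) hη h

end Summit.Parity.BatemanHorn.Theorems
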